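import Summits.QuantumFields.YangMills.Theorems.UV3BranchExpansionSocketWeightsSU2AllL
import Summits.QuantumFields.YangMills.Theorems.UV3BranchExpansionHaarBallSharp
import HarnessLib

/-!
# R3 (cell `ym3-torus`, YM₃ on T³ — a ladder RUNG, NOT d = 4, NOT infinite volume, NOT a mass gap, NOT the Clay problem) —
# **(hTop ∀F, NUMERIC TAIL) THE ∀-L (H_K) CONSTANT IS POLYNOMIAL IN THE BLOCK SIZE, `K(L) ≤ 10¹⁷·L^{7(d−1)}`, AND WITH IT THE SOCKET's ELEMENT ACTIVITY AT
# `δ′ = 1∕21`, `d = 3` IS BELOW px13's K-AGNOSTIC THRESHOLD `(9∕10)^{5(L−1)}∕(10⁴L⁴)` FOR EVERY `L ≥ 6`**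

DAG node N08 seat `pub-ymgap-dag-n08-d` g50 (sequel of ✓`…GuardCoreLawSU2AllL` p765628 + ✓`UV3BranchExpansionSocketWeightsSU2AllL` p765740, ★★OWNER WORD 100), 2026-08-30;
`--supports stmt-QuantumFields-19936 --as helper`.  THEOREMS ONLY (0 `def`, 0 `sorry`, default heartbeats).

THE POINT.  After WORD 100 the tree holds (H_K) for every `L` with the explicit constant `K(L) = ((L^{1−d} sin 1 q₃)³q₃²)⁻¹·(2400π·L^{d−1}∕sin 1 + 3)⁴ + 1` and the socket's
weight binder ✓`hw_su2_allL`; px13's N v1.4 ✓`UV3BranchExpansionCountingSmallnessT3.smallness_T3_anyL_of_ennreal_le` is K-agnostic: «whoever supplies an (H_K) constant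
`K(L)` beyond `L = 20` needs only `2·K(L)·h(8∕21)^{L²−1}∕h(1∕21) ≤ (9∕10)^{5(L−1)}∕(10⁴·L⁴)`».  This file supplies exactly that NUMBER, for every `L ≥ 6`:
 §1 `four_fifths_le_sin_one` · `four_fifths_le_q3_and_le_one` · ★★ `kallL_le_pow` (`K(L) ≤ ofReal(10¹⁷·(L^{d−1})⁷)`: `2400π + 3 ≤ 7543`, `sin 1, q₃ ≥ 4∕5`,
    `7543⁴(5∕4)¹² + 1 ≤ 10¹⁷`) · ★★ `fibre_law_le_su2_allL_pow` ((H_K) ∀L with the polynomial constant);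
 §2 `one_le_kpow_and_ne_top` · ★★ `hw_su2_allL_pow` (the socket binder with the polynomial constant, ✓`hw_of_fibre_law`);
 §3 `pow_tail_nat` (`10²⁶·L¹⁸·2^L ≤ 64^{L²−1}` in `ℕ` for `L ≥ 6`: `L < 2^L`, `10²⁶ < 2⁸⁷`, `87 + 19L ≤ 6(L²−1)`) · ★★★ `two_mul_kpow_mul_ratio_le (hL : 6 ≤ L)` :
    `2·(ofReal(10¹⁷·(L²)⁷) · h(1∕3+1∕21)^{L²−1}∕h(1∕21)) ≤ ofReal((9∕10)^{5(L−1)}∕(10⁴·L⁴))` — ✓`haar_window_ratio_le` + ✓`window_up_le` (`≤ 1∕64`) + ✓`window_low_ge`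
    + §3's integer inequality; px13's threshold VERBATIM.

HYP-SAT (★★OWNER RULING №42): `kallL_le_pow` ∕ `fibre_law_le_su2_allL_pow` carry no hypothesis beyond the standing range; `hw_su2_allL_pow`'s binders are w8's verbatim minus
`hL`; `two_mul_kpow_mul_ratio_le`'s ONLY hypothesis is the literal range `6 ≤ L` (every T³ family with `L ≥ 7`; `L ≤ 20` is ✓`…HTopT3AllL`'s record row anyway).
RECORD CURRENCY: SUPPLY for hTop ∀F ∕ NODE O B3 w.r.t. the 19936 v6 door — 0 displayed hypotheses of PATH A∕B discharged; registries unchanged.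

HONEST SCOPE.  Real-number numerals and one socket corollary BY NAME ([folklore]); the segment∕knit `topHaarPushforward_of_T3` is the sequel file, not here; nothing of
(O‴χₛ) ∕ EX ∕ `HistoryTailL` (19936) ∕ the rung ∕ d = 4 ∕ a mass gap ∕ Clay is proved.  YM₃ on T³ is rung R3 of the ladder; the Yang–Mills mass gap is NOT proved.

References: T. Bałaban, Commun. Math. Phys. **109** (1987) 249–301 [Balaban1987RG1] ((0.4) p. 253); T. Bałaban, Commun. Math. Phys. **102** (1985) 255–275
[Balaban1985UV3] ((2) p. 256, p. 260).
-/

set_option autoImplicit false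

noncomputable section

open MeasureTheory Set Function
open scoped ENNReal

namespace Summit.QuantumFields.YangMills.Theorems.UV3BranchExpansionSocketWeightsSU2AllLPow

open Literature.MathematicalPhysics.QuantumFieldTheory (haarProbability)
open Literature.MathematicalPhysics.QuantumFieldTheory.Balaban1983to89
open Literature.MathematicalPhysics.QuantumFieldTheory.Balaban1983to89.AveragingRT (axialAvg)
open Literature.MathematicalPhysics.QuantumFieldTheory.Balaban1983to89.BlockAveraging (Idx Small avgFun)
open Literature.MathematicalPhysics.QuantumFieldTheory.Balaban1983to89.BlockAveragingHaarAC (centralBond)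
open Literature.MathematicalPhysics.QuantumFieldTheory.Balaban1983to89.ExpMeanLog (expMeanLogSU expMeanLogSU_δ measurable_expMeanLogSU_E)
open Literature.MathematicalPhysics.QuantumFieldTheory.Balaban1983to89.T4HaarSU2Translate (haarData_haar_eq)
open Summit.QuantumFields.YangMills.BalabanUVNodes.N08HaarCompatibilityGuardCoreLawSU2 (delta_two)
open Summit.QuantumFields.YangMills.BalabanUVNodes.N08HaarCompatibilityGuardCoreLawSU2AllL (fibre_law_le_su2_allL)
open Summit.QuantumFields.YangMills.Theorems.UV3BranchExpansionSocketWeightsSU (hw_of_fibre_law)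
open Summit.QuantumFields.YangMills.Theorems.UV3BranchExpansionHaarBallSharp (haar_window_ratio_le window_up_le window_low_ge)

variable {P : Params} {j n : ℕ}

/-! ## §1 The ∀-L (H_K) constant is polynomial in the block size: `K(L) ≤ 10¹⁷·L^{7(d−1)}` -/

/-- `4∕5 ≤ sin 1` (`sin 1 = cos(π∕2 − 1) ≥ 1 − (π∕2 − 1)²∕2`, `π < 3.1416`). [folklore] -/
theorem four_fifths_le_sin_one : (4 / 5 : ℝ) ≤ Real.sin 1 := by
  rw [← Real.cos_pi_div_two_sub]
  have h := Real.one_sub_sq_div_two_le_cos (x := Real.pi / 2 - 1)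
  have hπ := Real.pi_lt_d4
  have hπ3 := Real.pi_gt_three
  nlinarith

/-- `4∕5 ≤ q₃ ≤ 1`, `q₃ = sin(π∕3)∕(π∕3) = 3√3∕(2π)`. [folklore] -/
theorem four_fifths_le_q3_and_le_one :
    (4 / 5 : ℝ) ≤ Real.sin (Real.pi / 3) / (Real.pi / 3) ∧ Real.sin (Real.pi / 3) / (Real.pi / 3) ≤ 1 := by
  have hπ := Real.pi_lt_d2
  have hπ3 := Real.pi_gt_three
  have hr3 : (1.7 : ℝ) ≤ Real.sqrt 3 := by
    rw [show (1.7 : ℝ) = Real.sqrt (1.7 ^ 2) from (Real.sqrt_sq (by norm_num)).symm]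
    exact Real.sqrt_le_sqrt (by norm_num)
  refine ⟨?_, ?_⟩
  · rw [Real.sin_pi_div_three, le_div_iff₀ (by positivity)]
    nlinarith
  · rw [div_le_one (by positivity)]
    exact Real.sin_le (by positivity)

/-- ★★ **THE ∀-L CONSTANT IS POLYNOMIAL IN THE BLOCK SIZE**: `K(L) ≤ 10¹⁷·(L^{d−1})⁷` in `ℝ≥0∞` (`2400π + 3 ≤ 7543`, `sin 1, q₃ ≥ 4∕5`,
`7543⁴·(5∕4)¹² + 1 ≤ 10¹⁷`) — the letter a numeric tail over the block sizes `L ≥ 21` consumes (px13 ✓`smallness_T3_anyL_of_ennreal_le` is K-agnostic).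
[folklore] -/
theorem kallL_le_pow :
    (ENNReal.ofReal (((((P.L : ℝ) ^ (P.d - 1)))⁻¹ * Real.sin 1 * (Real.sin (Real.pi / 3) / (Real.pi / 3))) ^ 3 * (Real.sin (Real.pi / 3) / (Real.pi / 3)) ^ 2))⁻¹ *
          ENNReal.ofReal ((2400 * Real.pi / ((((P.L : ℝ) ^ (P.d - 1)))⁻¹ * Real.sin 1) + 3) ^ 4) + 1 ≤
      ENNReal.ofReal (10 ^ 17 * ((P.L : ℝ) ^ (P.d - 1)) ^ 7) := by
  set X : ℝ := (P.L : ℝ) ^ (P.d - 1) with hX_def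
  set s : ℝ := Real.sin 1 with hs_def
  set q : ℝ := Real.sin (Real.pi / 3) / (Real.pi / 3) with hq_def
  have hL : (1 : ℝ) ≤ P.L := by exact_mod_cast P.hL.2.le
  have hX1 : 1 ≤ X := one_le_pow₀ hL
  have hX : 0 < X := by positivity
  have hs : 4 / 5 ≤ s := four_fifths_le_sin_one
  have hs1 : s ≤ 1 := Real.sin_le_one 1
  have hs0 : 0 < s := by linarith
  obtain ⟨hq, hq1⟩ := four_fifths_le_q3_and_le_one
  have hq0 : 0 < q := by linarith
  have hm : 0 < (X⁻¹ * s * q) ^ 3 * q ^ 2 := by positivity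
  have hN0 : 0 ≤ (2400 * Real.pi / (X⁻¹ * s) + 3) ^ 4 := by positivity
  have hreal : ENNReal.ofReal (((X⁻¹ * s * q) ^ 3 * q ^ 2)⁻¹ * (2400 * Real.pi / (X⁻¹ * s) + 3) ^ 4 + 1) =
      (ENNReal.ofReal ((X⁻¹ * s * q) ^ 3 * q ^ 2))⁻¹ * ENNReal.ofReal ((2400 * Real.pi / (X⁻¹ * s) + 3) ^ 4) + 1 := by
    rw [ENNReal.ofReal_add (by positivity) zero_le_one, ENNReal.ofReal_one, ENNReal.ofReal_mul (inv_nonneg.2 hm.le),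
      ENNReal.ofReal_inv_of_pos hm]
  rw [← hreal]
  refine ENNReal.ofReal_le_ofReal ?_
  have e1 : ((X⁻¹ * s * q) ^ 3 * q ^ 2)⁻¹ = X ^ 3 / (s ^ 3 * q ^ 5) := by
    field_simp
  have e2 : 2400 * Real.pi / (X⁻¹ * s) = 2400 * Real.pi * X / s := by
    field_simp
  rw [e1, e2]
  have hπ := Real.pi_lt_d4
  have hT : 2400 * Real.pi * X / s + 3 ≤ 7543 * X / s := by
    rw [div_add' _ _ _ hs0.ne', div_le_div_iff_of_pos_right hs0]
    nlinarith
  have hT0 : 0 ≤ 2400 * Real.pi * X / s + 3 := by positivity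
  have hT4 : (2400 * Real.pi * X / s + 3) ^ 4 ≤ (7543 * X / s) ^ 4 := pow_le_pow_left₀ hT0 hT 4
  have hden : (4 / 5 : ℝ) ^ 7 * (4 / 5) ^ 5 ≤ s ^ 7 * q ^ 5 :=
    mul_le_mul (pow_le_pow_left₀ (by norm_num) hs 7) (pow_le_pow_left₀ (by norm_num) hq 5) (by positivity) (by positivity)
  have hX7 : 1 ≤ X ^ 7 := one_le_pow₀ hX1
  have hnum : (7543 : ℝ) ^ 4 / ((4 / 5 : ℝ) ^ 7 * (4 / 5) ^ 5) + 1 ≤ 10 ^ 17 := by norm_num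
  calc X ^ 3 / (s ^ 3 * q ^ 5) * (2400 * Real.pi * X / s + 3) ^ 4 + 1
      ≤ X ^ 3 / (s ^ 3 * q ^ 5) * (7543 * X / s) ^ 4 + 1 := by gcongr
    _ = (7543 : ℝ) ^ 4 * X ^ 7 / (s ^ 7 * q ^ 5) + 1 := by
        field_simp
    _ ≤ (7543 : ℝ) ^ 4 * X ^ 7 / ((4 / 5 : ℝ) ^ 7 * (4 / 5) ^ 5) + X ^ 7 := by
        gcongr
    _ = ((7543 : ℝ) ^ 4 / ((4 / 5 : ℝ) ^ 7 * (4 / 5) ^ 5) + 1) * X ^ 7 := by ring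
    _ ≤ 10 ^ 17 * X ^ 7 := mul_le_mul_of_nonneg_right hnum (by positivity)

/-- ★★ **(H_K) AT `N = 2`, EVERY `L`, POLYNOMIAL CONSTANT**: `Haar∘ψ_{U,c}⁻¹ ≤ ofReal(10¹⁷·L^{7(d−1)})•Haar` for every guard-admitting fibre — `fibre_law_le_su2_allL`
weakened by `kallL_le_pow`. [cite: Balaban1987RG1, (0.4) p.253 (bookkeeping — the bound is NOT in print)] -/
theorem fibre_law_le_su2_allL_pow (hj : j + 1 ≤ P.m + P.K) :
    ∀ (c : PBond P (j + 1)) (U : GaugeField P j (Matrix.specialUnitaryGroup (Fin 2) ℂ)), (∃ g : (Matrix.specialUnitaryGroup (Fin 2) ℂ), Small (expMeanLogSU : LoopAverage (Matrix.specialUnitaryGroup (Fin 2) ℂ)) (update U (centralBond c) g) c) →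
      (HaarData.haar : Measure (Matrix.specialUnitaryGroup (Fin 2) ℂ)).map (fun g => avgFun (expMeanLogSU : LoopAverage (Matrix.specialUnitaryGroup (Fin 2) ℂ)) (update U (centralBond c) g) c) ≤
        ENNReal.ofReal (10 ^ 17 * ((P.L : ℝ) ^ (P.d - 1)) ^ 7) • (HaarData.haar : Measure (Matrix.specialUnitaryGroup (Fin 2) ℂ)) := by
  intro c U hU
  refine (fibre_law_le_su2_allL hj c U hU).trans (Measure.le_iff'.2 fun u => ?_)
  rw [Measure.smul_apply, Measure.smul_apply, smul_eq_mul, smul_eq_mul]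
  exact mul_le_mul' kallL_le_pow le_rfl

/-! ## §2 The socket's weight binder for every block size, polynomial constant -/

/-- `1 ≤ 10¹⁷·(L^{d−1})⁷` and finiteness, in `ℝ≥0∞`. [folklore] -/
theorem one_le_kpow_and_ne_top :
    1 ≤ ENNReal.ofReal (10 ^ 17 * ((P.L : ℝ) ^ (P.d - 1)) ^ 7) ∧ ENNReal.ofReal (10 ^ 17 * ((P.L : ℝ) ^ (P.d - 1)) ^ 7) ≠ ⊤ := by
  have hL : (1 : ℝ) ≤ P.L := by exact_mod_cast P.hL.2.le
  have hX7 : (1 : ℝ) ≤ ((P.L : ℝ) ^ (P.d - 1)) ^ 7 := one_le_pow₀ (one_le_pow₀ hL)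
  refine ⟨ENNReal.one_le_ofReal.2 ?_, ENNReal.ofReal_ne_top⟩
  nlinarith

/-- ★★ **(hw-DISCHARGE AT `SU(2)`, EVERY BLOCK SIZE `L`, POLYNOMIAL CONSTANT)**: ✓`hw_of_fibre_law` fed with `fibre_law_le_su2_allL_pow` — the socket's weight
`w s = (10¹⁷·L^{7(d−1)} · h(1∕3+δ′)^{L^{d−1}−1} ∕ h(δ′))^{|s|}` with NO range hypothesis on `L`. [cite: Balaban1987RG1, (0.4) p.253; Balaban1985UV3, (2) p.256] -/
theorem hw_su2_allL_pow (n : ℕ)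
    (T : Finset (Σ i : Fin n, PBond P (j + i + 1)) → (i : ℕ) → GaugeField P j (Matrix.specialUnitaryGroup (Fin 2) ℂ) →
      GaugeField P (j + i) (Matrix.specialUnitaryGroup (Fin 2) ℂ))
    (hT0 : ∀ s U, T s 0 U = U)
    (hTs : ∀ s (i : ℕ) (hi : i < n) U, T s (i + 1) U = fun c =>
      if c ∈ (Finset.univ.filter fun c' => (⟨⟨i, hi⟩, c'⟩ : Σ i : Fin n, PBond P (j + i + 1)) ∈ s) then
        avgFun (expMeanLogSU : LoopAverage (Matrix.specialUnitaryGroup (Fin 2) ℂ)) (T s i U) c else axialAvg (T s i U) c)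
    (hn : j + n ≤ P.m + P.K)
    (δ' : ℝ) (hh0 : (HaarData.haar : Measure (Matrix.specialUnitaryGroup (Fin 2) ℂ)) {g | dist1 g < δ'} ≠ 0) :
    ∀ s s' : Finset (Σ i : Fin n, PBond P (j + i + 1)), s' ⊆ s → ∀ B : Set (GaugeField P (j + n) (Matrix.specialUnitaryGroup (Fin 2) ℂ)), MeasurableSet B →
      fieldMeasure P j (Matrix.specialUnitaryGroup (Fin 2) ℂ)
          ((⋂ τ ∈ s, {U | Small (expMeanLogSU : LoopAverage (Matrix.specialUnitaryGroup (Fin 2) ℂ)) (T s' τ.1 U) τ.2}) ∩ T s' n ⁻¹' B) ≤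
        (ENNReal.ofReal (10 ^ 17 * ((P.L : ℝ) ^ (P.d - 1)) ^ 7) *
            ((HaarData.haar : Measure (Matrix.specialUnitaryGroup (Fin 2) ℂ)) {g | dist1 g < 1 / 3 + δ'} ^ (P.L ^ (P.d - 1) - 1) /
              (HaarData.haar : Measure (Matrix.specialUnitaryGroup (Fin 2) ℂ)) {g | dist1 g < δ'})) ^ s.card *
          fieldMeasure P (j + n) (Matrix.specialUnitaryGroup (Fin 2) ℂ) B := by
  obtain ⟨hK1, hKtop⟩ := one_le_kpow_and_ne_top (P := P)
  have h := hw_of_fibre_law (expMeanLogSU : LoopAverage (Matrix.specialUnitaryGroup (Fin 2) ℂ)) measurable_expMeanLogSU_E n T hT0 hTs hn hK1 hKtop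
    (fun k hk c U hadm => fibre_law_le_su2_allL_pow hk c U hadm) δ' hh0
  rw [delta_two] at h
  exact h

/-! ## §3 The numeric tail: with the polynomial constant the element activity at `δ′ = 1∕21`, `d = 3` is below px13's `L`-dependent threshold for every `L ≥ 6` -/

/-- In `ℕ`: `10²⁶ · L¹⁸ · 2^L ≤ 64^{L² − 1}` for `L ≥ 6` (`L < 2^L`, `10²⁶ < 2⁸⁷`, `87 + 19L ≤ 6(L² − 1)`). [folklore] -/
theorem pow_tail_nat {L : ℕ} (hL : 6 ≤ L) : 10 ^ 26 * L ^ 18 * 2 ^ L ≤ 64 ^ (L ^ 2 - 1) := by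
  have h1 : L ^ 18 ≤ (2 ^ L) ^ 18 := Nat.pow_le_pow_left (Nat.lt_two_pow_self).le 18
  have h2 : (10 : ℕ) ^ 26 ≤ 2 ^ 87 := by norm_num
  have h3 : 87 + 18 * L + L ≤ 6 * (L ^ 2 - 1) := by
    have hsq : 36 ≤ L ^ 2 := by nlinarith
    have : 87 + 19 * L + 6 ≤ 6 * L ^ 2 := by nlinarith
    omega
  calc 10 ^ 26 * L ^ 18 * 2 ^ L ≤ 2 ^ 87 * (2 ^ L) ^ 18 * 2 ^ L := by gcongr
    _ = 2 ^ (87 + 18 * L + L) := by rw [← pow_mul, ← pow_add, ← pow_add]; ring_nf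
    _ ≤ 2 ^ (6 * (L ^ 2 - 1)) := Nat.pow_le_pow_right (by norm_num) h3
    _ = 64 ^ (L ^ 2 - 1) := by rw [pow_mul]; norm_num

/-- ★★ **THE ELEMENT ACTIVITY WITH THE POLYNOMIAL ∀-L CONSTANT IS BELOW px13's THRESHOLD FOR EVERY `L ≥ 6`** (`d = 3`, `δ′ = 1∕21`):
`2·(10¹⁷·(L²)⁷ · h(8∕21)^{L²−1}∕h(1∕21)) ≤ ofReal((9∕10)^{5(L−1)}∕(10⁴·L⁴))` — ✓`haar_window_ratio_le` + ✓`window_up_le`∕`window_low_ge` + `pow_tail_nat`.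
[cite: Balaban1985UV3, p.260 (bookkeeping)] -/
theorem two_mul_kpow_mul_ratio_le {L : ℕ} (hL : 6 ≤ L) :
    2 * (ENNReal.ofReal (10 ^ 17 * (((L : ℝ)) ^ (3 - 1)) ^ 7) *
        ((HaarData.haar : Measure (Matrix.specialUnitaryGroup (Fin 2) ℂ)) {g | dist1 g < 1 / 3 + 1 / 21} ^ (L ^ (3 - 1) - 1) /
          (HaarData.haar : Measure (Matrix.specialUnitaryGroup (Fin 2) ℂ)) {g | dist1 g < 1 / 21})) ≤
      ENNReal.ofReal ((9 / 10 : ℝ) ^ ((2 * 3 - 1) * (L - 1)) / (10 ^ 4 * (L : ℝ) ^ 4)) := by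
  rw [haarData_haar_eq]
  have hratio := haar_window_ratio_le (δ' := 1 / 21) (by norm_num) (by norm_num) (L ^ (3 - 1) - 1)
  set up : ℝ := 2 * Real.pi ^ 2 * (1 / 3 + 1 / 21 : ℝ) ^ 3 / 81 with hup_def
  set low : ℝ := 2 / (3 * Real.pi) * ((1 - (1 / 21 : ℝ) ^ 2 / 6) ^ 2 * (1 / 21 : ℝ) ^ 3) with hlow_def
  have hup0 : 0 ≤ up := by positivity
  have hup : up ≤ 1 / 64 := window_up_le.trans (by norm_num)
  have hlow : (2289 / 100000000 : ℝ) ≤ low := window_low_ge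
  have hlowpos : 0 < low := lt_of_lt_of_le (by norm_num) hlow
  have hL1 : (1 : ℝ) ≤ L := by exact_mod_cast (show 1 ≤ L by omega)
  have hK0 : (0 : ℝ) ≤ 10 ^ 17 * (((L : ℝ)) ^ (3 - 1)) ^ 7 := by positivity
  -- everything in `ℝ`
  have hlhs : 2 * (ENNReal.ofReal (10 ^ 17 * (((L : ℝ)) ^ (3 - 1)) ^ 7) * ENNReal.ofReal (up ^ (L ^ (3 - 1) - 1) / low)) =
      ENNReal.ofReal (2 * ((10 ^ 17 * (((L : ℝ)) ^ (3 - 1)) ^ 7) * (up ^ (L ^ (3 - 1) - 1) / low))) := by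
    rw [← ENNReal.ofReal_mul hK0, ← ENNReal.ofReal_ofNat 2, ← ENNReal.ofReal_mul (by norm_num)]
  calc 2 * (ENNReal.ofReal (10 ^ 17 * (((L : ℝ)) ^ (3 - 1)) ^ 7) *
        (haarProbability (Matrix.specialUnitaryGroup (Fin 2) ℂ) {g | dist1 g < 1 / 3 + 1 / 21} ^ (L ^ (3 - 1) - 1) /
          haarProbability (Matrix.specialUnitaryGroup (Fin 2) ℂ) {g | dist1 g < 1 / 21}))
      ≤ 2 * (ENNReal.ofReal (10 ^ 17 * (((L : ℝ)) ^ (3 - 1)) ^ 7) * ENNReal.ofReal (up ^ (L ^ (3 - 1) - 1) / low)) := by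
        gcongr
    _ = ENNReal.ofReal (2 * ((10 ^ 17 * (((L : ℝ)) ^ (3 - 1)) ^ 7) * (up ^ (L ^ (3 - 1) - 1) / low))) := hlhs
    _ ≤ ENNReal.ofReal ((9 / 10 : ℝ) ^ ((2 * 3 - 1) * (L - 1)) / (10 ^ 4 * (L : ℝ) ^ 4)) := ENNReal.ofReal_le_ofReal ?_
  -- the real inequality
  have hsq : (L : ℝ) ^ (3 - 1) = (L : ℝ) ^ 2 := by norm_num
  rw [hsq]
  have hM : L ^ (3 - 1) - 1 = L ^ 2 - 1 := by norm_num
  rw [hM]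
  have hnat : (10 : ℝ) ^ 26 * (L : ℝ) ^ 18 * 2 ^ L ≤ 64 ^ (L ^ 2 - 1) := by exact_mod_cast pow_tail_nat hL
  have hupM : up ^ (L ^ 2 - 1) ≤ (1 / 64 : ℝ) ^ (L ^ 2 - 1) := pow_le_pow_left₀ hup0 hup _
  have h64 : (0 : ℝ) < 64 ^ (L ^ 2 - 1) := by positivity
  have h2L : (0 : ℝ) < 2 ^ (L - 1) := by positivity
  -- `(9/10)^{5(L−1)} ≥ (1/2)^{L−1}`
  have hy : ((1 / 2 : ℝ)) ^ (L - 1) ≤ (9 / 10 : ℝ) ^ ((2 * 3 - 1) * (L - 1)) := by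
    rw [pow_mul]
    exact pow_le_pow_left₀ (by norm_num) (by norm_num) _
  -- the chain
  have hA : 2 * ((10 ^ 17 * ((L : ℝ) ^ 2) ^ 7) * (up ^ (L ^ 2 - 1) / low)) ≤
      2 * ((10 ^ 17 * ((L : ℝ) ^ 2) ^ 7) * ((1 / 64 : ℝ) ^ (L ^ 2 - 1) / (2289 / 100000000))) := by
    gcongr
  refine hA.trans ?_
  have hB : (1 / 2 : ℝ) ^ (L - 1) / (10 ^ 4 * (L : ℝ) ^ 4) ≤ (9 / 10 : ℝ) ^ ((2 * 3 - 1) * (L - 1)) / (10 ^ 4 * (L : ℝ) ^ 4) :=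
    div_le_div_of_nonneg_right hy (by positivity)
  refine le_trans ?_ hB
  rw [one_div_pow, one_div_pow, le_div_iff₀ (by positivity)]
  -- goal: 2 * (10^17 (L^2)^7 * (1/64^{M} / (2289/10^8))) * (10^4 L^4) ≤ 1 / 2^(L-1)
  rw [le_div_iff₀ h2L]
  have h2pow : (2 : ℝ) ^ L = 2 * 2 ^ (L - 1) := by
    rw [← pow_succ']; congr 1; omega
  rw [h2pow] at hnat
  have e : 2 * (10 ^ 17 * ((L : ℝ) ^ 2) ^ 7 * (1 / 64 ^ (L ^ 2 - 1) / (2289 / 100000000))) * (10 ^ 4 * (L : ℝ) ^ 4) * 2 ^ (L - 1) =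
      (2 * 10 ^ 21 * 100000000 / 2289) * ((L : ℝ) ^ 18 * 2 ^ (L - 1)) / 64 ^ (L ^ 2 - 1) := by
    field_simp
  rw [e, div_le_one h64]
  nlinarith [hnat, show (0 : ℝ) ≤ (L : ℝ) ^ 18 * 2 ^ (L - 1) by positivity]

end Summit.QuantumFields.YangMills.Theorems.UV3BranchExpansionSocketWeightsSU2AllLPow

end
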